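import Summits.HubbardSuperconductivity.HubbardSuperconductivity.Theorems.AnisotropyChordTransferFibre3N1RowObjJPair

/-!
# Route `AnisotropyChord` / H0 rotor rung, LEVEL 2 row `N₁`: the OBJECT `Ĵ₁ = θ⁴Σ_kΣ_e bcSummand` lies in its `RExpr` bracket

Fifth and last instance of the object layer: for a ground two-magnon profile (`L ≥ 16`, `0 ≤ Δ < 1`) and the true vector
`X = xTrue L Δ λ₂ f a` (`t = θ²`), with `bcJ k := Σ_{e ∈ nn} bcSummand(e, k)`
(`bcSummand = Re(φ̂_e(k)^*φ̂_e(k′))(F₂(k) + F₂(k′)) + |φ̂_e(k)|²F₂(k′)`, `k′ = k + x̂`; `B_C = −3·(Σ_k bcJ k)/V` by `BCOneLoop`),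
★ `j1Hat_mem`: `(J1lo 2).eval X ≤ t²·Σ_k bcJ(k) ≤ (J1hi 2).eval X`.
Pieces: the pair split `𝕋 = {0} ⊔ {−x̂} ⊔ blockP ⊔ outerP`; the two special pairs (`special_bounds`, `φ̂_e(0) = γ`), the block pairs
(`pair_bounds`), the closed outer part (`eval_J1o0Full/At`) and the four clipped tails against `OuterMaj.bc_outer_bound`
(`eval_J1t·Full/At`, `κ̂′`, `m₀ = 13/10`).
Prover seat `hubbard-h0-rotor-p2` g5; helper for piece A = stmt-HubbardSuperconductivity-23918 of rung 19089
(`--supports`, helper class).  Nothing here proves superconductivity in the Hubbard model; helper lemmas of ONE conditional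
reduction (the GM₃ ∀L certificate, Level-2 row `N₁`); the rotor TARGET as originally worded stays FALSE (g15 verdict).
Mathlib + the tree only; no sorry.
-/

set_option linter.dupNamespace false
set_option autoImplicit false

open Literature.Analysis.ValidatedNumerics

namespace Summit.HubbardSuperconductivity.HubbardSuperconductivity.Theorems.AnisotropyChord.Transfer.Fibre3.L2.N1

variable (L : ℕ) [NeZero L] (Δ lam2 : ℝ) (f : Tor L → ℝ)

/-- the direction-summed `B_C` summand `bcJ(k) = Σ_{e ∈ nn} bcSummand(e, k)`. -/
noncomputable def bcJ (k : Tor L) : ℝ := ((nnList L).map (fun e => bcSummand L f e k)).sum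

/-- the four outer tail majorants summed: `t1 + t2 + t4 + t5`. -/
noncomputable def jTail (k : Tor L) : ℝ :=
  jRabs L Δ lam2 f k * kapP L Δ lam2 f * (gres L lam2 k + gres L lam2 (k + K1 L)) + jD1 L Δ lam2 f k * jZ L Δ lam2 f k
    + MK L Δ lam2 f k * kapP L Δ lam2 f * gres L lam2 (k + K1 L) + YP2 L Δ lam2 f k * acZ L Δ lam2 f (k + K1 L)

/-- the closed outer summand `o0 = R(c + c′) + Mc′`. -/
noncomputable def jO0 (k : Tor L) : ℝ :=
  RK L Δ lam2 f k * (cK L Δ lam2 f k + cK L Δ lam2 f (k + K1 L)) + MK L Δ lam2 f k * cK L Δ lam2 f (k + K1 L)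

/-! ## The two special pairs -/

/-- the `B_C` summand at a pair with `φ̂_e` real-valued `γ` at one end: `k = 0` and `k = −x̂`. -/
theorem bcSummand_special (hL : 5 ≤ L) (hΔ0 : 0 ≤ Δ) (hf : IsGroundTwoMagnon L Δ lam2 f) (hlam : 0 < lam2)
    (e : Tor L) (he : e ∈ nnList L) :
    bcSummand L f e 0 = gamPar L Δ lam2 f * (phiHat L f e (K1 L)).re * (F2 L f 0 + F2 L f (K1 L))
        + gamPar L Δ lam2 f ^ 2 * F2 L f (K1 L) ∧
    bcSummand L f e (-K1 L) = gamPar L Δ lam2 f * (phiHat L f e (-K1 L)).re * (F2 L f (-K1 L) + F2 L f 0)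
        + Complex.normSq (phiHat L f e (-K1 L)) * F2 L f 0 := by
  have h0 := (OuterMaj.phiHatClosedPlusTail_holds L hL hΔ0 lam2 f hf hlam e he).1
  unfold bcSummand
  rw [zero_add, neg_add_cancel, h0, Complex.conj_ofReal, Complex.normSq_ofReal]
  refine ⟨?_, ?_⟩
  · simp only [Complex.mul_re, Complex.ofReal_re, Complex.ofReal_im, zero_mul, sub_zero]; ring
  · simp only [Complex.mul_re, Complex.conj_re, Complex.conj_im, Complex.ofReal_re, Complex.ofReal_im, mul_zero, sub_zero]
    ring

/-- ★ `pair0Lo.eval X ≤ t²·bcJ(0) ≤ pair0Hi.eval X`. -/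
theorem pair0_bounds (hL : 7 ≤ L) (hΔ0 : 0 ≤ Δ) (hΔ1 : Δ < 1) (hf : IsGroundTwoMagnon L Δ lam2 f) (hlam : 0 < lam2) :
    (pair0Lo 3).eval (xTrue L Δ lam2 f (Δ * f (K1 L))) ≤ ((2 * Real.pi / L) ^ 2) ^ 2 * bcJ L f 0 ∧
    ((2 * Real.pi / L) ^ 2) ^ 2 * bcJ L f 0 ≤ (pair0Hi 3).eval (xTrue L Δ lam2 f (Δ * f (K1 L))) := by
  set X := xTrue L Δ lam2 f (Δ * f (K1 L)) with hXdef
  set t : ℝ := (2 * Real.pi / L) ^ 2 with ht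
  have hp : ((1 : ℤ), (0 : ℤ)) ∈ gridPts 3 := axis_mem_gridPts_three.1
  have hF0 : F0h.eval X = t * F2 L f 0 := eval_F0h L Δ lam2 f (by omega) hΔ0 hΔ1 hf hlam
  have hF1 : (Fh 3 ((1 : ℤ), (0 : ℤ))).eval X = t * F2 L f (K1 L) := by
    rw [hXdef, eval_Fh L Δ lam2 f (by omega) hΔ0 hΔ1 hf hlam hp, ClosedExp.toTor_one_zero]
  have hg := eval_gam1 L Δ lam2 f (by omega) hΔ0 hΔ1 hf hlam
  have hX0 : X 0 = t := xTrue_zero L Δ lam2 f _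
  have hsp : ∀ e ∈ E4, (r0 3 (1, 0) e).eval X - (dev0 3 (1, 0) e).eval X
        ≤ t * (gamPar L Δ lam2 f * (phiHat L f (B1.toTor L e) (K1 L)).re) ∧
      t * (gamPar L Δ lam2 f * (phiHat L f (B1.toTor L e) (K1 L)).re)
        ≤ (r0 3 (1, 0) e).eval X + (dev0 3 (1, 0) e).eval X := by
    intro e he
    have := special_bounds L Δ lam2 f hL hΔ0 hΔ1 hf hlam hp he
    rwa [ClosedExp.toTor_one_zero] at this
  have htrue : t ^ 2 * bcJ L f 0 = (E4.map fun e => t * (gamPar L Δ lam2 f * (phiHat L f (B1.toTor L e) (K1 L)).re)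
        * (t * F2 L f 0 + t * F2 L f (K1 L)) + t * gamPar L Δ lam2 f ^ 2 * (t * F2 L f (K1 L))).sum := by
    unfold bcJ
    rw [nnList_eq_map, List.map_map]
    have hc : ∀ e ∈ E4, ((fun e => bcSummand L f e 0) ∘ B1.toTor L) e
        = gamPar L Δ lam2 f * (phiHat L f (B1.toTor L e) (K1 L)).re * (F2 L f 0 + F2 L f (K1 L))
          + gamPar L Δ lam2 f ^ 2 * F2 L f (K1 L) :=
      fun e he => (bcSummand_special L Δ lam2 f (by omega) hΔ0 hf hlam _ (toTor_mem_nnList L he)).1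
    rw [List.map_congr_left hc]
    simp only [E4, List.map_cons, List.map_nil, List.sum_cons, List.sum_nil]
    ring
  constructor
  · have e1 : (pair0Lo 3).eval X = (E4.map fun e =>
        min (((r0 3 (1, 0) e).eval X - (dev0 3 (1, 0) e).eval X) * (F0h.eval X + (Fh 3 ((1 : ℤ), (0 : ℤ))).eval X))
            (((r0 3 (1, 0) e).eval X + (dev0 3 (1, 0) e).eval X) * (F0h.eval X + (Fh 3 ((1 : ℤ), (0 : ℤ))).eval X))
        + X 0 * (gam1.eval X) ^ 2 * (Fh 3 ((1 : ℤ), (0 : ℤ))).eval X).sum := by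
      simp only [pair0Lo, mulLo, eval_rsum, List.map_map, Function.comp_def, RExpr.eval, vT]
    rw [e1, htrue]
    refine List.sum_le_sum fun e he => ?_
    rw [hF0, hF1, hg, hX0]
    exact add_le_add (min_mul_le (hsp e he).1 (hsp e he).2 _) (le_of_eq (by ring))
  · have e1 : (pair0Hi 3).eval X = (E4.map fun e =>
        max (((r0 3 (1, 0) e).eval X - (dev0 3 (1, 0) e).eval X) * (F0h.eval X + (Fh 3 ((1 : ℤ), (0 : ℤ))).eval X))
            (((r0 3 (1, 0) e).eval X + (dev0 3 (1, 0) e).eval X) * (F0h.eval X + (Fh 3 ((1 : ℤ), (0 : ℤ))).eval X))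
        + X 0 * (gam1.eval X) ^ 2 * (Fh 3 ((1 : ℤ), (0 : ℤ))).eval X).sum := by
      simp only [pair0Hi, mulHi, eval_rsum, List.map_map, Function.comp_def, RExpr.eval, vT]
    rw [e1, htrue]
    refine List.sum_le_sum fun e he => ?_
    rw [hF0, hF1, hg, hX0]
    exact add_le_add (mul_le_max (hsp e he).1 (hsp e he).2 _) (le_of_eq (by ring))

/-- ★ `pairMLo.eval X ≤ t²·bcJ(−x̂) ≤ pairMHi.eval X`. -/
theorem pairM_bounds (hL : 7 ≤ L) (hΔ0 : 0 ≤ Δ) (hΔ1 : Δ < 1) (hf : IsGroundTwoMagnon L Δ lam2 f) (hlam : 0 < lam2) :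
    (pairMLo 3).eval (xTrue L Δ lam2 f (Δ * f (K1 L))) ≤ ((2 * Real.pi / L) ^ 2) ^ 2 * bcJ L f (-K1 L) ∧
    ((2 * Real.pi / L) ^ 2) ^ 2 * bcJ L f (-K1 L) ≤ (pairMHi 3).eval (xTrue L Δ lam2 f (Δ * f (K1 L))) := by
  set X := xTrue L Δ lam2 f (Δ * f (K1 L)) with hXdef
  set t : ℝ := (2 * Real.pi / L) ^ 2 with ht
  have hp : ((-1 : ℤ), (0 : ℤ)) ∈ gridPts 3 := axis_mem_gridPts_three.2
  have hF0 : F0h.eval X = t * F2 L f 0 := eval_F0h L Δ lam2 f (by omega) hΔ0 hΔ1 hf hlam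
  have hF1 : (Fh 3 ((-1 : ℤ), (0 : ℤ))).eval X = t * F2 L f (-K1 L) := by
    rw [hXdef, eval_Fh L Δ lam2 f (by omega) hΔ0 hΔ1 hf hlam hp, OuterMaj.toTor_neg_one_zero]
  have hsp : ∀ e ∈ E4, (r0 3 (-1, 0) e).eval X - (dev0 3 (-1, 0) e).eval X
        ≤ t * (gamPar L Δ lam2 f * (phiHat L f (B1.toTor L e) (-K1 L)).re) ∧
      t * (gamPar L Δ lam2 f * (phiHat L f (B1.toTor L e) (-K1 L)).re)
        ≤ (r0 3 (-1, 0) e).eval X + (dev0 3 (-1, 0) e).eval X := by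
    intro e he
    have := special_bounds L Δ lam2 f hL hΔ0 hΔ1 hf hlam hp he
    rwa [OuterMaj.toTor_neg_one_zero] at this
  have hker : ∀ e ∈ E4, (kerLo 3 (-1, 0) e).eval X ≤ t * Complex.normSq (phiHat L f (B1.toTor L e) (-K1 L)) ∧
      t * Complex.normSq (phiHat L f (B1.toTor L e) (-K1 L)) ≤ (kerHi 3 (-1, 0) e).eval X := by
    intro e he
    have := ker_bounds L Δ lam2 f hL hΔ0 hΔ1 hf hlam hp he
    rwa [OuterMaj.toTor_neg_one_zero] at this
  have htrue : t ^ 2 * bcJ L f (-K1 L) = (E4.map fun e => t * (gamPar L Δ lam2 f * (phiHat L f (B1.toTor L e) (-K1 L)).re)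
        * (t * F2 L f (-K1 L) + t * F2 L f 0) + t * Complex.normSq (phiHat L f (B1.toTor L e) (-K1 L)) * (t * F2 L f 0)).sum := by
    unfold bcJ
    rw [nnList_eq_map, List.map_map]
    have hc : ∀ e ∈ E4, ((fun e => bcSummand L f e (-K1 L)) ∘ B1.toTor L) e
        = gamPar L Δ lam2 f * (phiHat L f (B1.toTor L e) (-K1 L)).re * (F2 L f (-K1 L) + F2 L f 0)
          + Complex.normSq (phiHat L f (B1.toTor L e) (-K1 L)) * F2 L f 0 :=
      fun e he => (bcSummand_special L Δ lam2 f (by omega) hΔ0 hf hlam _ (toTor_mem_nnList L he)).2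
    rw [List.map_congr_left hc]
    simp only [E4, List.map_cons, List.map_nil, List.sum_cons, List.sum_nil]
    ring
  constructor
  · have e1 : (pairMLo 3).eval X = (E4.map fun e =>
        min (((r0 3 (-1, 0) e).eval X - (dev0 3 (-1, 0) e).eval X) * ((Fh 3 ((-1 : ℤ), (0 : ℤ))).eval X + F0h.eval X))
            (((r0 3 (-1, 0) e).eval X + (dev0 3 (-1, 0) e).eval X) * ((Fh 3 ((-1 : ℤ), (0 : ℤ))).eval X + F0h.eval X))
        + min ((kerLo 3 (-1, 0) e).eval X * F0h.eval X) ((kerHi 3 (-1, 0) e).eval X * F0h.eval X)).sum := by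
      simp only [pairMLo, mulLo, eval_rsum, List.map_map, Function.comp_def, RExpr.eval]
    rw [e1, htrue]
    refine List.sum_le_sum fun e he => ?_
    rw [hF0, hF1]
    exact add_le_add (min_mul_le (hsp e he).1 (hsp e he).2 _) (min_mul_le (hker e he).1 (hker e he).2 _)
  · have e1 : (pairMHi 3).eval X = (E4.map fun e =>
        max (((r0 3 (-1, 0) e).eval X - (dev0 3 (-1, 0) e).eval X) * ((Fh 3 ((-1 : ℤ), (0 : ℤ))).eval X + F0h.eval X))
            (((r0 3 (-1, 0) e).eval X + (dev0 3 (-1, 0) e).eval X) * ((Fh 3 ((-1 : ℤ), (0 : ℤ))).eval X + F0h.eval X))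
        + max ((kerLo 3 (-1, 0) e).eval X * F0h.eval X) ((kerHi 3 (-1, 0) e).eval X * F0h.eval X)).sum := by
      simp only [pairMHi, mulHi, eval_rsum, List.map_map, Function.comp_def, RExpr.eval]
    rw [e1, htrue]
    refine List.sum_le_sum fun e he => ?_
    rw [hF0, hF1]
    exact add_le_add (mul_le_max (hsp e he).1 (hsp e he).2 _) (mul_le_max (hker e he).1 (hker e he).2 _)

/-! ## ★ The object `Ĵ₁` is in its bracket -/

/-- ★★ **`Ĵ₁ = θ⁴Σ_k bcJ(k) ∈ [J1lo, J1hi]` at the true vector** (ground profile, `L ≥ 16`, `0 ≤ Δ < 1`, `c_sG̃(0) > 0`). -/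
theorem j1Hat_mem (hL : 16 ≤ L) (hΔ0 : 0 ≤ Δ) (hΔ1 : Δ < 1) (hf : IsGroundTwoMagnon L Δ lam2 f) (hlam : 0 < lam2)
    (h2 : 2 * lam2 < eps1 L) (hu : 0 < cS L Δ lam2 f * Gzero L lam2) :
    (J1lo 2).eval (xTrue L Δ lam2 f (Δ * f (K1 L))) ≤ ((2 * Real.pi / L) ^ 2) ^ 2 * ∑ k : Tor L, bcJ L f k ∧
    ((2 * Real.pi / L) ^ 2) ^ 2 * ∑ k : Tor L, bcJ L f k ≤ (J1hi 2).eval (xTrue L Δ lam2 f (Δ * f (K1 L))) := by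
  classical
  set X := xTrue L Δ lam2 f (Δ * f (K1 L)) with hXdef
  set t : ℝ := (2 * Real.pi / L) ^ 2 with htdef
  have hLpos : (0 : ℝ) < L := by exact_mod_cast (show 0 < L by omega)
  have ht2 : 0 ≤ t ^ 2 := by positivity
  set TP := torPrime L with hTP
  set BP := Fibre3.blockP L 2 with hBP
  -- the per-pair outer values
  have hAt0 : ∀ q ∈ blockP 2, (J1o0At 3 q).eval X = t ^ 2 * jO0 L Δ lam2 f (B1.toTor L q) := fun q hq =>
    eval_J1o0At L Δ lam2 f (by omega) hΔ0 hΔ1 hf hlam h2 hu (blockP_two_grid q hq).1 (blockP_two_grid q hq).2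
  have hAtT : ∀ q ∈ blockP 2, (rsum [J1t1At 3 q, J1t2At 3 q, J1t4At 3 q, J1t5At 3 q]).eval X
      = t ^ 2 * jTail L Δ lam2 f (B1.toTor L q) := by
    intro q hq
    obtain ⟨g1, g2⟩ := blockP_two_grid q hq
    simp only [rsum, RExpr.eval]
    rw [eval_J1t1At L Δ lam2 f (by omega) hΔ0 hΔ1 hf hlam h2 hu g1 g2, eval_J1t2At L Δ lam2 f (by omega) hΔ0 hΔ1 hf hlam h2 hu g1 g2,
      eval_J1t4At L Δ lam2 f (by omega) hΔ0 hΔ1 hf hlam h2 hu g1 g2, eval_J1t5At L Δ lam2 f (by omega) hΔ0 hΔ1 hf hlam h2 hu g1 g2]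
    unfold jTail; ring
  have hFo : (J1o0Full 3).eval X = t ^ 2 * ∑ k ∈ TP, jO0 L Δ lam2 f k :=
    eval_J1o0Full L Δ lam2 f (by omega) hΔ0 hΔ1 hf hlam h2 hu
  have hF1 := eval_J1t1Full L Δ lam2 f (by omega) hΔ0 hΔ1 hf hlam h2 hu
  have hF2 := eval_J1t2Full L Δ lam2 f (by omega) hΔ0 hΔ1 hf hlam h2 hu
  have hF4 := eval_J1t4Full L Δ lam2 f (by omega) hΔ0 hΔ1 hf hlam h2 hu
  have hF5 := eval_J1t5Full L Δ lam2 f (by omega) hΔ0 hΔ1 hf hlam h2 hu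
  -- block list sums ↦ Finset sums
  have bO : ((blockP 2).map fun q => (J1o0At 3 q).eval X).sum = t ^ 2 * ∑ k ∈ BP, jO0 L Δ lam2 f k := by
    rw [hBP, blockP_sum_eq L (by omega), ← List.sum_map_mul_left]
    exact congrArg List.sum (List.map_congr_left fun q hq => hAt0 q hq)
  have bT : ∀ (G : ℤ × ℤ → RExpr) (g : Tor L → ℝ), (∀ q ∈ blockP 2, (G q).eval X = t ^ 2 * g (B1.toTor L q)) →
      ((blockP 2).map fun q => (G q).eval X).sum = t ^ 2 * ∑ k ∈ BP, g k := by
    intro G g hG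
    rw [hBP, blockP_sum_eq L (by omega), ← List.sum_map_mul_left]
    exact congrArg List.sum (List.map_congr_left fun q hq => hG q hq)
  set g1f : Tor L → ℝ := fun k => jRabs L Δ lam2 f k * kapP L Δ lam2 f * (gres L lam2 k + gres L lam2 (k + K1 L)) with hg1f
  set g2f : Tor L → ℝ := fun k => jD1 L Δ lam2 f k * jZ L Δ lam2 f k with hg2f
  set g4f : Tor L → ℝ := fun k => MK L Δ lam2 f k * kapP L Δ lam2 f * gres L lam2 (k + K1 L) with hg4f
  set g5f : Tor L → ℝ := fun k => YP2 L Δ lam2 f k * acZ L Δ lam2 f (k + K1 L) with hg5f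
  have b1 := bT (fun q => J1t1At 3 q) g1f fun q hq =>
    eval_J1t1At L Δ lam2 f (by omega) hΔ0 hΔ1 hf hlam h2 hu (blockP_two_grid q hq).1 (blockP_two_grid q hq).2
  have b2 := bT (fun q => J1t2At 3 q) g2f fun q hq =>
    eval_J1t2At L Δ lam2 f (by omega) hΔ0 hΔ1 hf hlam h2 hu (blockP_two_grid q hq).1 (blockP_two_grid q hq).2
  have b4 := bT (fun q => J1t4At 3 q) g4f fun q hq =>
    eval_J1t4At L Δ lam2 f (by omega) hΔ0 hΔ1 hf hlam h2 hu (blockP_two_grid q hq).1 (blockP_two_grid q hq).2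
  have b5 := bT (fun q => J1t5At 3 q) g5f fun q hq =>
    eval_J1t5At L Δ lam2 f (by omega) hΔ0 hΔ1 hf hlam h2 hu (blockP_two_grid q hq).1 (blockP_two_grid q hq).2
  have bLo : ((blockP 2).map fun q => (pairLo 3 q).eval X).sum ≤ t ^ 2 * ∑ k ∈ BP, bcJ L f k := by
    rw [hBP, blockP_sum_eq L (by omega), ← List.sum_map_mul_left]
    exact List.sum_le_sum fun q hq => (pair_bounds L Δ lam2 f (by omega) hΔ0 hΔ1 hf hlam hq).1
  have bHi : t ^ 2 * ∑ k ∈ BP, bcJ L f k ≤ ((blockP 2).map fun q => (pairHi 3 q).eval X).sum := by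
    rw [hBP, blockP_sum_eq L (by omega), ← List.sum_map_mul_left]
    exact List.sum_le_sum fun q hq => (pair_bounds L Δ lam2 f (by omega) hΔ0 hΔ1 hf hlam hq).2
  -- the outer parts evaluated
  have eout : (J1outer 2).eval X = t ^ 2 * (∑ k ∈ TP, jO0 L Δ lam2 f k - ∑ k ∈ BP, jO0 L Δ lam2 f k) := by
    simp only [J1outer, RExpr.eval, eval_rsum, List.map_map, Nat.reduceAdd]
    have h1 : (List.map ((fun e => e.eval X) ∘ fun q => J1o0At 3 q) (blockP 2)).sum = t ^ 2 * ∑ k ∈ BP, jO0 L Δ lam2 f k := by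
      rw [← bO]; rfl
    rw [hFo, h1]; ring
  set A1 := t ^ 2 * (∑ k ∈ TP, g1f k - ∑ k ∈ BP, g1f k) with hA1
  set A2 := t ^ 2 * (∑ k ∈ TP, g2f k - ∑ k ∈ BP, g2f k) with hA2
  set A4 := t ^ 2 * (∑ k ∈ TP, g4f k - ∑ k ∈ BP, g4f k) with hA4
  set A5 := t ^ 2 * (∑ k ∈ TP, g5f k - ∑ k ∈ BP, g5f k) with hA5
  have etail : (J1tail 2).eval X = max A1 0 + max A2 0 + max A4 0 + max A5 0 := by
    simp only [J1tail, rsum, RExpr.eval, eval_rsum, List.map_map, cst, Nat.reduceAdd]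
    have h1 : (List.map ((fun e => e.eval X) ∘ fun q => J1t1At 3 q) (blockP 2)).sum = t ^ 2 * ∑ k ∈ BP, g1f k := by rw [← b1]; rfl
    have h2' : (List.map ((fun e => e.eval X) ∘ fun q => J1t2At 3 q) (blockP 2)).sum = t ^ 2 * ∑ k ∈ BP, g2f k := by rw [← b2]; rfl
    have h4 : (List.map ((fun e => e.eval X) ∘ fun q => J1t4At 3 q) (blockP 2)).sum = t ^ 2 * ∑ k ∈ BP, g4f k := by rw [← b4]; rfl
    have h5 : (List.map ((fun e => e.eval X) ∘ fun q => J1t5At 3 q) (blockP 2)).sum = t ^ 2 * ∑ k ∈ BP, g5f k := by rw [← b5]; rfl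
    rw [hF1, hF2, hF4, hF5, h1, h2', h4, h5]
    push_cast
    rw [hA1, hA2, hA4, hA5, htdef, hTP]
    ring_nf
  have ehi : (J1hi 2).eval X = (pair0Hi 3).eval X + (pairMHi 3).eval X + ((blockP 2).map fun q => (pairHi 3 q).eval X).sum
      + (J1outer 2).eval X + (J1tail 2).eval X := by
    simp only [J1hi, rsum, RExpr.eval, eval_rsum, List.map_map, Nat.reduceAdd]
    have : (List.map ((fun e => e.eval X) ∘ fun q => pairHi 3 q) (blockP 2)).sum
        = ((blockP 2).map fun q => (pairHi 3 q).eval X).sum := rfl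
    rw [this]; ring
  have elo : (J1lo 2).eval X = (pair0Lo 3).eval X + (pairMLo 3).eval X + ((blockP 2).map fun q => (pairLo 3 q).eval X).sum
      + (J1outer 2).eval X - (J1tail 2).eval X := by
    simp only [J1lo, rsum, RExpr.eval, eval_rsum, List.map_map, Nat.reduceAdd]
    have : (List.map ((fun e => e.eval X) ∘ fun q => pairLo 3 q) (blockP 2)).sum
        = ((blockP 2).map fun q => (pairLo 3 q).eval X).sum := rfl
    rw [this]; ring
  -- the true sum decomposed
  have split := OuterMaj.pairRegionSplit_holds L 2 (by omega) (fun k => bcJ L f k)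
  have hout : ∑ k ∈ Fibre3.outerP L 2, bcJ L f k
      = (∑ k ∈ TP, jO0 L Δ lam2 f k - ∑ k ∈ BP, jO0 L Δ lam2 f k) + ∑ k ∈ Fibre3.outerP L 2, (bcJ L f k - jO0 L Δ lam2 f k) := by
    rw [hTP, hBP, ← outerP_sum_eq L (by omega), ← Finset.sum_add_distrib]
    refine Finset.sum_congr rfl fun k _ => ?_; ring
  have hbd := OuterMaj.bc_outer_bound L (by omega) hΔ0 hΔ1 hf 2 (by omega) (m0 := 13 / 10) (by norm_num)
  dsimp only at hbd
  have hlhs : (∑ k ∈ Fibre3.outerP L 2, (((nnList L).map (fun e => bcSummand L f e k)).sum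
        - (RK L Δ lam2 f k * (cK L Δ lam2 f k + cK L Δ lam2 f (k + K1 L)) + MK L Δ lam2 f k * cK L Δ lam2 f (k + K1 L))))
      = ∑ k ∈ Fibre3.outerP L 2, (bcJ L f k - jO0 L Δ lam2 f k) := rfl
  have hrhs : ∑ k ∈ Fibre3.outerP L 2,
      (( betaK L Δ lam2 f k * betaK L Δ lam2 f (k + K1 L) * (EK L k + EK L (k + K1 L) + 2 * eps1 L)
          + qPar L Δ f / 2 * (betaK L Δ lam2 f k + betaK L Δ lam2 f (k + K1 L)) * (2 * eps1 L + EK L k + EK L (k + K1 L))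
          + 4 * qPar L Δ f ^ 2)
        * (kapHat L Δ lam2 f 2 + 2 * aPar L Δ f * cS L Δ lam2 f / (L : ℝ) ^ 2) * (gres L lam2 k + gres L lam2 (k + K1 L))
      + ((kapHat L Δ lam2 f 2 + 2 * aPar L Δ f * cS L Δ lam2 f / (L : ℝ) ^ 2) / 2 * betaK L Δ lam2 f k * gres L lam2 (k + K1 L)
            * (EK L k + EK L (k + K1 L))
          + tauBar L Δ lam2 f * (betaK L Δ lam2 f k ^ 2 * EK L k / (2 * (13 / 10)) + 13 / 10)
          + (kapHat L Δ lam2 f 2 + 2 * aPar L Δ f * cS L Δ lam2 f / (L : ℝ) ^ 2) / 2 * betaK L Δ lam2 f (k + K1 L) * gres L lam2 k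
            * (EK L k + EK L (k + K1 L))
          + tauBar L Δ lam2 f * (betaK L Δ lam2 f (k + K1 L) ^ 2 * EK L (k + K1 L) / (2 * (13 / 10)) + 13 / 10)
          + 4 * qPar L Δ f * tauBar L Δ lam2 f + tauBar L Δ lam2 f ^ 2
          + (4 * qPar L Δ f * (kapHat L Δ lam2 f 2 + 2 * aPar L Δ f * cS L Δ lam2 f / (L : ℝ) ^ 2)
              + 2 * tauBar L Δ lam2 f * (kapHat L Δ lam2 f 2 + 2 * aPar L Δ f * cS L Δ lam2 f / (L : ℝ) ^ 2))
            * (gres L lam2 k + gres L lam2 (k + K1 L))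
          + (kapHat L Δ lam2 f 2 + 2 * aPar L Δ f * cS L Δ lam2 f / (L : ℝ) ^ 2) ^ 2 / 4 * gres L lam2 k * gres L lam2 (k + K1 L)
            * (EK L k + EK L (k + K1 L)))
        * ((2 * cS L Δ lam2 f * gres L lam2 k + dPar L Δ f) + (2 * cS L Δ lam2 f * gres L lam2 (k + K1 L) + dPar L Δ f)
          + (kapHat L Δ lam2 f 2 + 2 * aPar L Δ f * cS L Δ lam2 f / (L : ℝ) ^ 2) * (gres L lam2 k + gres L lam2 (k + K1 L)))
      + MK L Δ lam2 f k * (kapHat L Δ lam2 f 2 + 2 * aPar L Δ f * cS L Δ lam2 f / (L : ℝ) ^ 2) * gres L lam2 (k + K1 L)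
      + ((2 * betaK L Δ lam2 f k * (kapHat L Δ lam2 f 2 + 2 * aPar L Δ f * cS L Δ lam2 f / (L : ℝ) ^ 2) * gres L lam2 k * EK L k
          + tauBar L Δ lam2 f * (betaK L Δ lam2 f k ^ 2 * EK L k / (13 / 10) + 2 * (13 / 10))
          + 8 * qPar L Δ f * (kapHat L Δ lam2 f 2 + 2 * aPar L Δ f * cS L Δ lam2 f / (L : ℝ) ^ 2) * gres L lam2 k
          + 4 * qPar L Δ f * tauBar L Δ lam2 f)
        + (EK L k * (kapHat L Δ lam2 f 2 + 2 * aPar L Δ f * cS L Δ lam2 f / (L : ℝ) ^ 2) ^ 2 * gres L lam2 k ^ 2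
          + 2 * tauBar L Δ lam2 f ^ 2))
        * ((2 * cS L Δ lam2 f * gres L lam2 (k + K1 L) + dPar L Δ f)
          + (kapHat L Δ lam2 f 2 + 2 * aPar L Δ f * cS L Δ lam2 f / (L : ℝ) ^ 2) * gres L lam2 (k + K1 L)))
      = (∑ k ∈ TP, g1f k - ∑ k ∈ BP, g1f k) + (∑ k ∈ TP, g2f k - ∑ k ∈ BP, g2f k)
        + (∑ k ∈ TP, g4f k - ∑ k ∈ BP, g4f k) + (∑ k ∈ TP, g5f k - ∑ k ∈ BP, g5f k) := by
    rw [hTP, hBP, ← outerP_sum_eq L (by omega), ← outerP_sum_eq L (by omega), ← outerP_sum_eq L (by omega),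
      ← outerP_sum_eq L (by omega), ← Finset.sum_add_distrib, ← Finset.sum_add_distrib, ← Finset.sum_add_distrib]
    refine Finset.sum_congr rfl fun k _ => ?_
    rw [hg1f, hg2f, hg4f, hg5f]
    unfold jRabs jD1 jZ YP2 acZ kapP
    ring
  rw [hlhs, hrhs] at hbd
  obtain ⟨hlow, hupp⟩ := abs_le.1 hbd
  have key : t ^ 2 * ∑ k : Tor L, bcJ L f k
      = t ^ 2 * bcJ L f 0 + t ^ 2 * bcJ L f (-K1 L) + t ^ 2 * ∑ k ∈ BP, bcJ L f k
        + t ^ 2 * (∑ k ∈ TP, jO0 L Δ lam2 f k - ∑ k ∈ BP, jO0 L Δ lam2 f k)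
        + t ^ 2 * ∑ k ∈ Fibre3.outerP L 2, (bcJ L f k - jO0 L Δ lam2 f k) := by
    rw [split, hout, hBP]; ring
  have hAsum : A1 + A2 + A4 + A5 = t ^ 2 * ((∑ k ∈ TP, g1f k - ∑ k ∈ BP, g1f k) + (∑ k ∈ TP, g2f k - ∑ k ∈ BP, g2f k)
      + (∑ k ∈ TP, g4f k - ∑ k ∈ BP, g4f k) + (∑ k ∈ TP, g5f k - ∑ k ∈ BP, g5f k)) := by
    rw [hA1, hA2, hA4, hA5]; ring
  have hm1 := le_max_left A1 0
  have hm2 := le_max_left A2 0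
  have hm4 := le_max_left A4 0
  have hm5 := le_max_left A5 0
  have hU := mul_le_mul_of_nonneg_left hupp ht2
  have hD := mul_le_mul_of_nonneg_left hlow ht2
  obtain ⟨p0lo, p0hi⟩ := pair0_bounds L Δ lam2 f (by omega) hΔ0 hΔ1 hf hlam
  obtain ⟨pMlo, pMhi⟩ := pairM_bounds L Δ lam2 f (by omega) hΔ0 hΔ1 hf hlam
  rw [ehi, elo, eout, etail, key]
  constructor
  · linarith [bLo, hm1, hm2, hm4, hm5, hD, hAsum, p0lo, pMlo]
  · linarith [bHi, hm1, hm2, hm4, hm5, hU, hAsum, p0hi, pMhi]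

end Summit.HubbardSuperconductivity.HubbardSuperconductivity.Theorems.AnisotropyChord.Transfer.Fibre3.L2.N1
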